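import Summits.QuantumFields.BalabanUV.T4Continuum.Support.NE7EtaRatesD4Holder
import HarnessLib

/-!
# NE7EtaClosenessHolder — route #1 of the NE7 crux (node U5), socket `h` AMENDMENT 5 (ROAD-G106 §4): THE AMENDED SOCKET `h′` and the
# consumer-side END of the background coordinate from it — `NE7EtaCurlFromCovGradient.closeness_of_covRoot₂` with (Lip₂′ᶜ) (second covariant
# differences at the full scale `ξ³`, C^{1,1}-level) REPLACED by (Höl½ᶜ) (transported Hölder-½ drift of the covariant gradient along lines,
# `≤ Λ_H·√j·ξ²√ξ` — [Balaban1985RegularSpaces] Thm 2 (1.36) `‖A‖_{1,½}` SHAPE), rate base `θ^{18} = L⁻¹`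

Cell `pub-balaban`, rung (B)+1 sub-cell t4, lineage `b2b-balaban-t4-ne7-p1`, generation 106 (CRUX PROVER NE7 #1 = OWNER of BINDER row NE7).
Memo `t4/b2b-balaban-t4-ne7-p1-g106/ROAD-G106.md` §4.

THE AMENDED SOCKET `h′` (INTERFACE REQUEST NE7→NE3 AMENDMENT 5, proposed; the END chain of record still displays amendment 4's `h`): for every
level `k ≥ 1`, datum `V ∈ dom`, level-`k` minimiser `U_A`, `Regular b g` level-`(k+1)` minimiser `U_B` (`W := rescale L (bavg L U_B)`):
`∃ u Z`, unitary∕periodic `u`, skew∕periodic `Z`, `gaugeAct u U_A = vary W Z 1`,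
  (E)     `energyNormW L k W Z (periodBox (N L^k)) ≤ C·residualScale 4 L N b g k`                       [row NE3's T-E_w♯ — PROVED at SU(2)∕SU(3), gen 105],
  (Lip₁ᶜ) `‖Ad (W (x+e κ) μ) (Z (x+e μ) κ) − Z x κ‖ ≤ Λ₁·ξ²`                                            [[B8] Thm 2 (1.36) `|∇_{U₀}A|` SHAPE],
  (Höl½ᶜ) `‖Ad (∏_{i<j} W (y+e κ+i•e μ) μ) (D(y + j•e μ)) − D(y)‖ ≤ Λ_H·√j·ξ²·√ξ` for all `κ μ y j`      [[B8] Thm 2 (1.36) `‖A‖_{1,½}` SHAPE],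
where `D(y) := Ad (W (y+e κ) μ) (Z (y+e μ) κ) − Z y κ` and `ξ = (L⁻¹)^k`.  The old socket implies the new one on ranges `j ≤ R`
(`NE7EtaHolderJunction.holderHalf_of_lip2c`); the new one is what a sup-norm gauge-fixing theorem of printed TYPE delivers (β₀ < 1).
WHAT ([folklore]; 0 def, 0 sorry).  `theta18_lt_one`, `covRootH_mono` (monotonicity of `h′` in `C, Λ₁, Λ_H`), and **`closeness_of_covRootH`** (`d = 4`, `L ≥ 2`, `N ≥ 1`, `θ^{18} = L⁻¹`, class data `0 ≤ b`, `512·5·8·L²·b ≤ 1`,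
`0 ≤ g`, `0 ≤ C`, budget `γ > 0` with `C·ρ₄ ≤ γ³`, cube root `l₁ > 0` with `Λ₁ ≤ l₁³`, `Λ_H ≥ 0`): at every level `k ≥ 1` with the FIT `γ(θ^{3k})² ≤ l₁N`,
for every datum and minimiser pair, `∃ u Z` with the representation and
  (P) `‖Z x κ‖ ≤ 8l₁²γ·θ^{24k}`,  (Gᶜ) `‖Ad (W (x+e κ) μ) (Z (x+e μ) κ) − Z x κ‖ ≤ (16l₁²γ + √2Λ_H)·θ^{38k}`,  (C) `‖d_W Z (x, π)‖ ≤ 2(16l₁²γ + √2Λ_H)·θ^{38k}`.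
In NODE O's reading (`L^k = θ^{−18k}`): `θ^{6k}` and `θ^{2k}` — geometric.  (The projection old ⇒ new at the level of ONE pair with a range cap is
`NE7EtaHolderJunction.holderHalf_of_lip2c`; the uncapped form needs (Lip₁ᶜ) beyond `j > L^k`, see the memo.)
HONEST FRAMING (page 1): bookkeeping over landed kernel lemmas; `h′` is a HYPOTHESIS here, asserted for no class; nothing of NE3∕NE7 discharged; the
re-threading of the END chain (`plain_closeness…` → `hclose_of_covRoot` → … → the docked ENDs) to `h′` is NOT done in this file; nothing of
Bałaban's asserted as an axiom; spine count = dagwriter∕referees' call; FIXED FINITE T⁴, rung (B)+1 — NOT infinite volume, NOT mass gap, NOT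
BetaPertH, NOT Clay (continuum YM on T⁴ ⇐ BetaPertH ∧ nine spine estimates).
-/

set_option autoImplicit false

open scoped BigOperators Matrix Matrix.Norms.L2Operator
open Finset

namespace Summit.QuantumFields.BalabanUV.T4Continuum.NE7EtaClosenessHolder

open Literature.MathematicalPhysics.QuantumFieldTheory.Balaban1983to89
open B7Prop1Explicit B7Prop2Explicit
open T4AveragingDeficitWall hiding Site Plane Plaq Bond
open T4AveragingDeficitWallBoundary (periodBox IsPeriodicCfg)
open AveragingDeficitPeriodicCounting (IsPeriodicDir)
open MinimalActionSandwich (IsMinimiser)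
open MinimalActionRate (Regular)
open NE3EnergyShapes (residualScale residualScale_nonneg IsUnitarySite IsPeriodicSite)
open NE3EnergyWeightedShapes (energyNormW energyNormW_nonneg)
open AveragingDeficitDualResidual (dualC1 dualC2)
open AveragingDeficitDerivWallProof (wallConst)
open NE7EtaRatesD4 (energy_budget_of_residualScale)
open NE7EtaRatesD4CovReg (unitary_periodic_rescale_bavg_of_regular)
open NE7EtaRatesD4Holder (norm_dir_le_rate_holder norm_covDiff_le_rate_holder norm_curl_le_rate_holder)

noncomputable section

variable {n : Type*} [Fintype n] [DecidableEq n]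

/-! ## §1 The base and the socket's monotonicity -/

/-- `θ^{18} = L⁻¹`, `L ≥ 2` ⟹ `θ < 1`. [folklore] -/
theorem theta18_lt_one {L : ℕ} (hL : 2 ≤ L) {θ : ℝ} (hθ18 : θ ^ 18 = ((L : ℝ))⁻¹) : θ < 1 := by
  by_contra hge
  push Not at hge
  have h1 : (1 : ℝ) ≤ θ ^ 18 := one_le_pow₀ hge
  have hL2 : (2 : ℝ) ≤ L := by exact_mod_cast hL
  have h2 : ((L : ℝ))⁻¹ ≤ 1 / 2 := by rw [inv_eq_one_div]; exact one_div_le_one_div_of_le (by norm_num) hL2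
  linarith [h1, h2, hθ18.symm.le]

/-- **MONOTONICITY OF THE AMENDED SOCKET** in its three constants `C ≤ C′`, `Λ₁ ≤ Λ₁′`, `Λ_H ≤ Λ_H′` (any `d`, class `𝒞`). [folklore] -/
theorem covRootH_mono {d : ℕ} {𝒞 : ℕ → Set (Site d → Fin d → (Matrix n n ℂ)ˣ)} {L N : ℕ} {b g C C' Λ₁ Λ₁' ΛH ΛH' : ℝ}
    {dom : Set (Site d → Fin d → (Matrix n n ℂ)ˣ)} (hCC : C ≤ C') (hΛΛ₁ : Λ₁ ≤ Λ₁') (hΛΛH : ΛH ≤ ΛH')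
    (h : ∀ k : ℕ, 1 ≤ k → ∀ V ∈ dom, ∀ UA UB : Site d → Fin d → (Matrix n n ℂ)ˣ,
      IsMinimiser d 𝒞 L N k V UA → IsMinimiser d 𝒞 L N (k + 1) V UB → Regular d L N b g (k + 1) UB →
        ∃ (u : Site d → (Matrix n n ℂ)ˣ) (Z : Site d → Fin d → Matrix n n ℂ),
          IsUnitarySite u ∧ IsPeriodicSite u ((N * L ^ k : ℕ) : ℤ) ∧
          IsSkewDir Z ∧ IsPeriodicDir Z ((N * L ^ k : ℕ) : ℤ) ∧
          gaugeAct u UA = vary (rescale L (bavg L UB)) Z 1 ∧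
          energyNormW L k (rescale L (bavg L UB)) Z (periodBox (N * L ^ k)) ≤ C * residualScale d L N b g k ∧
          (∀ (κ : Fin d) (x : Site d) (μ : Fin d),
            ‖Ad (rescale L (bavg L UB) (x + e κ) μ) (Z (x + e μ) κ) - Z x κ‖ ≤ Λ₁ * (((L : ℝ)⁻¹) ^ k) ^ 2) ∧
          (∀ (κ μ : Fin d) (y : Site d) (j : ℕ),
            ‖Ad (((List.range j).map fun i : ℕ => rescale L (bavg L UB) (y + e κ + i • e μ) μ).prod)
                  (Ad (rescale L (bavg L UB) (y + j • e μ + e κ) μ) (Z (y + j • e μ + e μ) κ) - Z (y + j • e μ) κ)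
                - (Ad (rescale L (bavg L UB) (y + e κ) μ) (Z (y + e μ) κ) - Z y κ)‖
              ≤ ΛH * Real.sqrt (j : ℝ) * (((L : ℝ)⁻¹) ^ k) ^ 2 * Real.sqrt (((L : ℝ)⁻¹) ^ k))) :
    ∀ k : ℕ, 1 ≤ k → ∀ V ∈ dom, ∀ UA UB : Site d → Fin d → (Matrix n n ℂ)ˣ,
      IsMinimiser d 𝒞 L N k V UA → IsMinimiser d 𝒞 L N (k + 1) V UB → Regular d L N b g (k + 1) UB →
        ∃ (u : Site d → (Matrix n n ℂ)ˣ) (Z : Site d → Fin d → Matrix n n ℂ),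
          IsUnitarySite u ∧ IsPeriodicSite u ((N * L ^ k : ℕ) : ℤ) ∧
          IsSkewDir Z ∧ IsPeriodicDir Z ((N * L ^ k : ℕ) : ℤ) ∧
          gaugeAct u UA = vary (rescale L (bavg L UB)) Z 1 ∧
          energyNormW L k (rescale L (bavg L UB)) Z (periodBox (N * L ^ k)) ≤ C' * residualScale d L N b g k ∧
          (∀ (κ : Fin d) (x : Site d) (μ : Fin d),
            ‖Ad (rescale L (bavg L UB) (x + e κ) μ) (Z (x + e μ) κ) - Z x κ‖ ≤ Λ₁' * (((L : ℝ)⁻¹) ^ k) ^ 2) ∧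
          (∀ (κ μ : Fin d) (y : Site d) (j : ℕ),
            ‖Ad (((List.range j).map fun i : ℕ => rescale L (bavg L UB) (y + e κ + i • e μ) μ).prod)
                  (Ad (rescale L (bavg L UB) (y + j • e μ + e κ) μ) (Z (y + j • e μ + e μ) κ) - Z (y + j • e μ) κ)
                - (Ad (rescale L (bavg L UB) (y + e κ) μ) (Z (y + e μ) κ) - Z y κ)‖
              ≤ ΛH' * Real.sqrt (j : ℝ) * (((L : ℝ)⁻¹) ^ k) ^ 2 * Real.sqrt (((L : ℝ)⁻¹) ^ k)) := by
  intro k hk V hV UA UB hA hB hreg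
  obtain ⟨u, Z, hu, huP, hZ, hZP, hrep, hE, hL1, hL2⟩ := h k hk V hV UA UB hA hB hreg
  have hξ : 0 ≤ ((L : ℝ)⁻¹) ^ k := by positivity
  refine ⟨u, Z, hu, huP, hZ, hZP, hrep, hE.trans (mul_le_mul_of_nonneg_right hCC (residualScale_nonneg d L N b g k)),
    fun κ x μ => (hL1 κ x μ).trans (mul_le_mul_of_nonneg_right hΛΛ₁ (by positivity)), fun κ μ y j => (hL2 κ μ y j).trans ?_⟩
  have h0 : 0 ≤ Real.sqrt (j : ℝ) * (((L : ℝ)⁻¹) ^ k) ^ 2 * Real.sqrt (((L : ℝ)⁻¹) ^ k) := by positivity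
  have := mul_le_mul_of_nonneg_right hΛΛH h0
  linarith [this]

/-! ## §2 The consumer-side END from `h′` -/

/-- **THE CONSUMER-SIDE END OF THE BACKGROUND COORDINATE FROM THE AMENDED SOCKET `h′` = (E) + (Lip₁ᶜ) + (Höl½ᶜ)** — statement in the module
docstring. [folklore] -/
theorem closeness_of_covRootH [Nonempty n] {𝒞 : ℕ → Set (Site 4 → Fin 4 → (Matrix n n ℂ)ˣ)} {L N : ℕ} (hL : 2 ≤ L)
    (hN : 1 ≤ N) {θ : ℝ} (hθ : 0 < θ) (hθ18 : θ ^ 18 = ((L : ℝ))⁻¹) {b g C Λ₁ ΛH : ℝ} (hb : 0 ≤ b)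
    (hbs : 512 * (4 + 1) * (4 + 4) * (L : ℝ) ^ 2 * b ≤ 1) (hg : 0 ≤ g) (hC : 0 ≤ C) (hΛH : 0 ≤ ΛH)
    {dom : Set (Site 4 → Fin 4 → (Matrix n n ℂ)ˣ)}
    (h : ∀ k : ℕ, 1 ≤ k → ∀ V ∈ dom, ∀ UA UB : Site 4 → Fin 4 → (Matrix n n ℂ)ˣ,
      IsMinimiser 4 𝒞 L N k V UA → IsMinimiser 4 𝒞 L N (k + 1) V UB → Regular 4 L N b g (k + 1) UB →
        ∃ (u : Site 4 → (Matrix n n ℂ)ˣ) (Z : Site 4 → Fin 4 → Matrix n n ℂ),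
          IsUnitarySite u ∧ IsPeriodicSite u ((N * L ^ k : ℕ) : ℤ) ∧
          IsSkewDir Z ∧ IsPeriodicDir Z ((N * L ^ k : ℕ) : ℤ) ∧
          gaugeAct u UA = vary (rescale L (bavg L UB)) Z 1 ∧
          energyNormW L k (rescale L (bavg L UB)) Z (periodBox (N * L ^ k)) ≤ C * residualScale 4 L N b g k ∧
          (∀ (κ : Fin 4) (x : Site 4) (μ : Fin 4),
            ‖Ad (rescale L (bavg L UB) (x + e κ) μ) (Z (x + e μ) κ) - Z x κ‖ ≤ Λ₁ * (((L : ℝ)⁻¹) ^ k) ^ 2) ∧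
          (∀ (κ μ : Fin 4) (y : Site 4) (j : ℕ),
            ‖Ad (((List.range j).map fun i : ℕ => rescale L (bavg L UB) (y + e κ + i • e μ) μ).prod)
                  (Ad (rescale L (bavg L UB) (y + j • e μ + e κ) μ) (Z (y + j • e μ + e μ) κ) - Z (y + j • e μ) κ)
                - (Ad (rescale L (bavg L UB) (y + e κ) μ) (Z (y + e μ) κ) - Z y κ)‖
              ≤ ΛH * Real.sqrt (j : ℝ) * (((L : ℝ)⁻¹) ^ k) ^ 2 * Real.sqrt (((L : ℝ)⁻¹) ^ k)))
    {γ l₁ : ℝ} (hγ : 0 < γ)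
    (hγ3 : C * (wallConst 4 L * (N : ℝ) ^ 2 * (Real.sqrt g * dualC2 4 L + 2 * b ^ 2 * dualC1 4 L)) ≤ γ ^ 3)
    (hl₁ : 0 < l₁) (hΛl₁ : Λ₁ ≤ l₁ ^ 3)
    {k : ℕ} (hk : 1 ≤ k) (hfit : γ * ((θ ^ 3) ^ k) ^ 2 ≤ l₁ * N)
    {V : Site 4 → Fin 4 → (Matrix n n ℂ)ˣ} (hV : V ∈ dom) {UA UB : Site 4 → Fin 4 → (Matrix n n ℂ)ˣ}
    (hA : IsMinimiser 4 𝒞 L N k V UA) (hB : IsMinimiser 4 𝒞 L N (k + 1) V UB) (hreg : Regular 4 L N b g (k + 1) UB) :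
    ∃ (u : Site 4 → (Matrix n n ℂ)ˣ) (Z : Site 4 → Fin 4 → Matrix n n ℂ),
      IsUnitarySite u ∧ IsPeriodicSite u ((N * L ^ k : ℕ) : ℤ) ∧ IsSkewDir Z ∧ IsPeriodicDir Z ((N * L ^ k : ℕ) : ℤ) ∧
      gaugeAct u UA = vary (rescale L (bavg L UB)) Z 1 ∧
      (∀ (x : Site 4) (κ : Fin 4), ‖Z x κ‖ ≤ 8 * l₁ ^ 2 * γ * θ ^ (24 * k)) ∧
      (∀ (x : Site 4) (μ κ : Fin 4),
        ‖Ad (rescale L (bavg L UB) (x + e κ) μ) (Z (x + e μ) κ) - Z x κ‖ ≤ (16 * l₁ ^ 2 * γ + Real.sqrt 2 * ΛH) * θ ^ (38 * k)) ∧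
      (∀ (π : T4AveragingDeficitWall.Plane 4) (x : Site 4),
        ‖curl (rescale L (bavg L UB)) Z (x, π)‖ ≤ 2 * ((16 * l₁ ^ 2 * γ + Real.sqrt 2 * ΛH) * θ ^ (38 * k))) := by
  obtain ⟨u, Z, hu, huP, hZ, hZP, hrep, hE, h1, h2⟩ := h k hk V hV UA UB hA hB hreg
  have hL1 : 1 ≤ L := by omega
  obtain ⟨hWu, hWP⟩ := unitary_periodic_rescale_bavg_of_regular hL1 hb hbs hreg
  have hEγ : (L : ℝ) ^ k * energyNormW L k (rescale L (bavg L UB)) Z (periodBox (d := 4) (N * L ^ k)) ≤ γ ^ 3 :=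
    (energy_budget_of_residualScale hL1 N b hg hC k hE).trans hγ3
  refine ⟨u, Z, hu, huP, hZ, hZP, hrep, ?_, ?_, ?_⟩
  · exact fun x κ => norm_dir_le_rate_holder hL hN hk hθ hθ18 hWu hWP hZP hγ hl₁ hΛl₁ hEγ h1 hfit x κ
  · exact fun x μ κ => norm_covDiff_le_rate_holder hL hN hk hθ hθ18 hWu hWP hZP hγ hl₁ hΛl₁ hΛH hEγ h1 h2 hfit x μ κ
  · exact fun π x => norm_curl_le_rate_holder hL hN hk hθ hθ18 hWu hWP hZP hγ hl₁ hΛl₁ hΛH hEγ h1 h2 hfit π x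

end

end Summit.QuantumFields.BalabanUV.T4Continuum.NE7EtaClosenessHolder
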